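import Mathlib.Analysis.SpecialFunctions.Complex.Log
import Mathlib.Analysis.SpecialFunctions.ExpDeriv
import Mathlib.Analysis.Calculus.MeanValue
import Mathlib.Analysis.Calculus.Deriv.Mul
import Mathlib.Analysis.Calculus.Deriv.Comp
import HarnessLib

/-!
# Holomorphic automorphisms of `ℂ^×` preserving the punctured unit disc ([IUTchI] Rmk 3.4.2)

S. Mochizuki, *Inter-universal Teichmüller theory I*, §3, Remark 3.4.2 (kurims final manuscript May
2020, p. 82) invokes "the elementary fact that every holomorphic automorphism of the complex Lie group
`ℂ^×` that preserves the submonoid of elements of norm `≤ 1` is equal to the identity" (it is what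
makes the Kummer structure `κ_v : 𝒪^▷(C_v) ↪ 𝒜_{D_v}` of Example 3.4 recoverable from the
Aut-holomorphic structure and co-holomorphicization it induces; the surrounding Remark is typed in
`ThetaHodgeTheatersRemarksA2.lean`, which does not import this file, nor conversely).
[claim: Mochizuki2012, status: disputed] — the bibliographic key carries the D-0012 status of the
series; the fact itself is classical and is PROVED here from Mathlib:

* `holAutUnits_eq_id_of_preservesDisc`: a group automorphism `φ` of `ℂ^×` which is holomorphic
  (complex-differentiable on `ℂ ∖ {0}` as a self-map of `ℂ`) and maps `{0 < ‖z‖ ≤ 1}` into itself is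
  the identity.  Proof: differentiating `φ(zw) = φ(z)φ(w)` at `w = 1` gives `z·φ′(z) = c·φ(z)` with
  `c = φ′(1)`; hence `φ(e^t)·e^{−ct}` has zero derivative, so `φ(e^t) = e^{ct}`; periodicity of `exp`
  forces `c ∈ ℤ`, so `φ(z) = z^c`; injectivity excludes `c = 0` and `c ≥ 2` (roots of unity), the
  disc condition excludes `c < 0`.  (Only injectivity of `φ` is used, not surjectivity, and no
  hypothesis on the inverse.)
* `norm_eq_one_of_preservesDisc`: the purely algebraic step — such a `φ` preserves the unit circle.

Wave-2 row W2-L5-01a (seat abc-iut-L3-t8).  A general complex-analysis lemma; librarians may re-home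
it under `Literature/Analysis/Complex/` (no IUT object is involved).
-/

namespace Literature.IUT.HodgeTheaters

open Complex

/-- An automorphism of the group `ℂ^×` mapping the punctured closed unit disc into itself preserves
the unit circle (apply the hypothesis to `u` and to `u⁻¹`). PROVED.
[claim: Mochizuki2012, status: disputed] -/
theorem norm_eq_one_of_preservesDisc (φ : ℂˣ ≃* ℂˣ)
    (hφ : ∀ u : ℂˣ, ‖(u : ℂ)‖ ≤ 1 → ‖((φ u : ℂˣ) : ℂ)‖ ≤ 1) (u : ℂˣ) (hu : ‖(u : ℂ)‖ = 1) :
    ‖((φ u : ℂˣ) : ℂ)‖ = 1 := by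
  have h1 : ‖((φ u : ℂˣ) : ℂ)‖ ≤ 1 := hφ u hu.le
  have hinv : ‖((u⁻¹ : ℂˣ) : ℂ)‖ ≤ 1 := by
    rw [Units.val_inv_eq_inv_val, norm_inv, hu, inv_one]
  have h2 := hφ u⁻¹ hinv
  rw [map_inv, Units.val_inv_eq_inv_val, norm_inv] at h2
  have hpos : 0 < ‖((φ u : ℂˣ) : ℂ)‖ := norm_pos_iff.mpr (φ u).ne_zero
  have h3 : 1 ≤ ‖((φ u : ℂˣ) : ℂ)‖ := by
    rwa [inv_le_one₀ hpos] at h2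
  exact le_antisymm h1 h3

/-- **[IUTchI] Rmk 3.4.2, the "elementary fact"** (p. 82): "every holomorphic automorphism of the
complex Lie group `ℂ^×` that preserves the submonoid of elements of norm `≤ 1` is equal to the
identity" — for `φ : ℂˣ ≃* ℂˣ` holomorphic (as the self-map of `ℂ` extended by `0` at `0`,
complex-differentiable on `ℂ ∖ {0}`) with `‖φ u‖ ≤ 1` whenever `‖u‖ ≤ 1`, `φ u = u` for all `u`.
PROVED. [claim: Mochizuki2012, status: disputed] -/
theorem holAutUnits_eq_id_of_preservesDisc (φ : ℂˣ ≃* ℂˣ)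
    (hdiff : DifferentiableOn ℂ
      (fun z : ℂ => if h : z = 0 then 0 else ((φ (Units.mk0 z h) : ℂˣ) : ℂ)) {z : ℂ | z ≠ 0})
    (hdisc : ∀ u : ℂˣ, ‖(u : ℂ)‖ ≤ 1 → ‖((φ u : ℂˣ) : ℂ)‖ ≤ 1) (u : ℂˣ) : φ u = u := by
  set f : ℂ → ℂ := fun z : ℂ => if h : z = 0 then 0 else ((φ (Units.mk0 z h) : ℂˣ) : ℂ) with hf
  -- `f` on units, nonvanishing, multiplicativity, `f 1 = 1`
  have f_mk0 : ∀ (z : ℂ) (hz : z ≠ 0), f z = ((φ (Units.mk0 z hz) : ℂˣ) : ℂ) := fun z hz => by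
    simp only [hf, dif_neg hz]
  have f_units : ∀ u : ℂˣ, f u = ((φ u : ℂˣ) : ℂ) := fun u => by
    rw [f_mk0 u u.ne_zero, Units.mk0_val]
  have f_ne : ∀ z : ℂ, z ≠ 0 → f z ≠ 0 := fun z hz => by
    rw [f_mk0 z hz]; exact (φ _).ne_zero
  have f_mul : ∀ z w : ℂ, z ≠ 0 → w ≠ 0 → f (z * w) = f z * f w := fun z w hz hw => by
    rw [f_mk0 z hz, f_mk0 w hw, f_mk0 (z * w) (mul_ne_zero hz hw), Units.mk0_mul, map_mul,
      Units.val_mul]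
  have f_one : f 1 = 1 := by
    rw [f_mk0 1 one_ne_zero, Units.mk0_one, map_one, Units.val_one]
  have f_inj : ∀ z w : ℂ, (hz : z ≠ 0) → (hw : w ≠ 0) → f z = f w → z = w := fun z w hz hw h => by
    rw [f_mk0 z hz, f_mk0 w hw] at h
    have := φ.injective (Units.ext h)
    rwa [Units.mk0_inj] at this
  -- differentiability at nonzero points
  have f_diffAt : ∀ z : ℂ, z ≠ 0 → DifferentiableAt ℂ f z := fun z hz =>
    (hdiff z hz).differentiableAt (isOpen_ne.mem_nhds hz)
  -- Step 1: `z · f'(z) = f(z) · c` with `c = f'(1)`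
  set c : ℂ := deriv f 1 with hc
  have key : ∀ z : ℂ, z ≠ 0 → z * deriv f z = f z * c := by
    intro z hz
    have h1 : HasDerivAt (fun w : ℂ => f (z * w)) (deriv f z * z) 1 := by
      have hz1 : HasDerivAt (fun w : ℂ => z * w) z 1 := hasDerivAt_const_mul z
      have hfz : HasDerivAt f (deriv f z) (z * 1) := by
        rw [mul_one]; exact (f_diffAt z hz).hasDerivAt
      exact hfz.comp 1 hz1
    have h2 : HasDerivAt (fun w : ℂ => f z * f w) (f z * c) 1 :=
      (f_diffAt 1 one_ne_zero).hasDerivAt.const_mul (f z)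
    have heq : (fun w : ℂ => f z * f w) =ᶠ[nhds 1] (fun w : ℂ => f (z * w)) := by
      filter_upwards [isOpen_ne.mem_nhds (one_ne_zero (α := ℂ))] with w hw
      exact (f_mul z w hz hw).symm
    have h3 : HasDerivAt (fun w : ℂ => f z * f w) (deriv f z * z) 1 := h1.congr_of_eventuallyEq heq
    have := h3.unique h2
    rw [mul_comm] at this
    exact this
  -- Step 2: `F(t) := f(exp t) · exp(−c t)` is constant `= 1`
  set F : ℂ → ℂ := fun t => f (exp t) * exp (-(c * t)) with hF
  have hFd : ∀ t : ℂ, HasDerivAt F 0 t := by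
    intro t
    have e1 : HasDerivAt (fun t : ℂ => f (exp t)) (deriv f (exp t) * exp t) t :=
      (f_diffAt _ (exp_ne_zero t)).hasDerivAt.comp t (Complex.hasDerivAt_exp t)
    have e2 : HasDerivAt (fun t : ℂ => exp (-(c * t))) (exp (-(c * t)) * (-c)) t := by
      have hlin : HasDerivAt (fun t : ℂ => -(c * t)) (-c) t := (hasDerivAt_const_mul c).neg
      exact (Complex.hasDerivAt_exp _).comp t hlin
    have e3 := e1.mul e2
    have hk := key (exp t) (exp_ne_zero t)
    refine e3.congr_deriv ?_
    linear_combination (exp (-(c * t))) * hk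
  have hFdiff : Differentiable ℂ F := fun t => (hFd t).differentiableAt
  have hFderiv : ∀ t, deriv F t = 0 := fun t => (hFd t).deriv
  have hF1 : ∀ t : ℂ, F t = 1 := by
    intro t
    have := is_const_of_deriv_eq_zero hFdiff hFderiv t 0
    rw [this]
    simp only [hF, exp_zero, mul_zero, neg_zero, f_one, mul_one]
  -- hence `f(exp t) = exp(c t)`
  have fexp : ∀ t : ℂ, f (exp t) = exp (c * t) := by
    intro t
    have h := hF1 t
    simp only [hF] at h
    calc f (exp t) = f (exp t) * exp (-(c * t)) * exp (c * t) := by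
          rw [mul_assoc, ← exp_add, neg_add_cancel, exp_zero, mul_one]
      _ = exp (c * t) := by rw [h, one_mul]
  -- Step 3: `c` is an integer
  have hcZ : ∃ n : ℤ, c = n := by
    have h := fexp (2 * Real.pi * I)
    rw [exp_two_pi_mul_I, f_one] at h
    obtain ⟨n, hn⟩ := Complex.exp_eq_one_iff.mp h.symm
    refine ⟨n, ?_⟩
    have h2pi : (2 * Real.pi * I : ℂ) ≠ 0 := by
      simp [Real.pi_ne_zero, I_ne_zero]
    exact mul_right_cancel₀ h2pi hn
  obtain ⟨n, hn⟩ := hcZ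
  -- Step 4: `f z = z ^ n`
  have fpow : ∀ z : ℂ, z ≠ 0 → f z = z ^ n := by
    intro z hz
    have h := fexp (log z)
    rw [exp_log hz] at h
    rw [h, hn, exp_int_mul, exp_log hz]
  -- Step 5: `n = 1`
  have hn1 : n = 1 := by
    rcases lt_trichotomy n 0 with hneg | hzero | hpos
    · -- negative exponent: `f(1/2) = 2^{-n}` has norm `> 1`, contradicting disc preservation
      exfalso
      have hhalf : (1 / 2 : ℂ) ≠ 0 := by norm_num
      have hle : ‖((φ (Units.mk0 (1 / 2 : ℂ) hhalf) : ℂˣ) : ℂ)‖ ≤ 1 := by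
        apply hdisc
        rw [Units.val_mk0]; norm_num
      rw [← f_mk0, fpow _ hhalf, norm_zpow] at hle
      have h2 : ‖(1 / 2 : ℂ)‖ = 1 / 2 := by norm_num
      rw [h2] at hle
      -- `(1/2)^n ≥ 2` for `n ≤ -1`
      obtain ⟨m, hm⟩ : ∃ m : ℕ, n = -((m : ℤ) + 1) := ⟨(-n - 1).toNat, by omega⟩
      rw [hm, zpow_neg, zpow_add₀ (by norm_num : (1 / 2 : ℝ) ≠ 0), zpow_natCast, zpow_one] at hle
      have hlt : (1 / 2 : ℝ) ^ m * (1 / 2) < 1 := by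
        have : (1 / 2 : ℝ) ^ m ≤ 1 := pow_le_one₀ (by norm_num) (by norm_num)
        nlinarith
      have hpos' : 0 < (1 / 2 : ℝ) ^ m * (1 / 2) := by positivity
      have : 1 < ((1 / 2 : ℝ) ^ m * (1 / 2))⁻¹ := by
        rw [lt_inv_comm₀ zero_lt_one hpos', inv_one]; exact hlt
      linarith
    · -- `n = 0`: `f` is constant, contradicting injectivity
      exfalso
      have h2 : f 2 = f 1 := by
        rw [fpow 2 two_ne_zero, fpow 1 one_ne_zero, hzero, zpow_zero, zpow_zero]
      exact absurd (f_inj 2 1 two_ne_zero one_ne_zero h2) (by norm_num)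
    · -- `n ≥ 1`: an `n`-th root of unity is sent to `1`, so `n ∣ 1`
      obtain ⟨m, rfl⟩ : ∃ m : ℕ, n = m := ⟨n.toNat, by omega⟩
      have hm0 : m ≠ 0 := by omega
      set ζ : ℂ := exp (2 * Real.pi * I * (1 : ℕ) / m) with hζ
      have hζne : ζ ≠ 0 := exp_ne_zero _
      have hζpow : ζ ^ (m : ℤ) = 1 := by
        rw [zpow_natCast, hζ, ← Complex.exp_nat_mul]
        have : (m : ℂ) * (2 * Real.pi * I * (1 : ℕ) / m) = 2 * Real.pi * I := by
          have hm' : (m : ℂ) ≠ 0 := Nat.cast_ne_zero.mpr hm0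
          rw [Nat.cast_one, mul_one, mul_div_cancel₀ _ hm']
        rw [this, exp_two_pi_mul_I]
      have hfζ : f ζ = f 1 := by
        rw [fpow ζ hζne, fpow 1 one_ne_zero, hζpow, one_zpow]
      have hζ1 : ζ = 1 := f_inj ζ 1 hζne one_ne_zero hfζ
      have hdvd : m ∣ 1 := (exp_two_pi_mul_I_mul_div_eq_one_iff hm0).mp hζ1
      have : m = 1 := Nat.dvd_one.mp hdvd
      simp [this]
  -- conclusion
  apply Units.ext
  rw [← f_units u, fpow u u.ne_zero, hn1, zpow_one]

/-- The classification behind the "elementary fact" of [IUTchI] Rmk 3.4.2 (p. 82), in reusable form: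
every holomorphic ENDOMORPHISM `φ` of the group `ℂ^×` (complex-differentiable on `ℂ ∖ {0}` as a
self-map of `ℂ` extended by `0` at `0`) is a power map: `φ u = u ^ n` for some `n ∈ ℤ` (namely
`n = φ′(1)`).  Same argument as `holAutUnits_eq_id_of_preservesDisc` without the injectivity
and disc hypotheses. PROVED. [claim: Mochizuki2012, status: disputed] -/
theorem exists_zpow_eq_of_holomorphic_unitsHom (φ : ℂˣ →* ℂˣ)
    (hdiff : DifferentiableOn ℂ
      (fun z : ℂ => if h : z = 0 then 0 else ((φ (Units.mk0 z h) : ℂˣ) : ℂ)) {z : ℂ | z ≠ 0}) :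
    ∃ n : ℤ, ∀ u : ℂˣ, φ u = u ^ n := by
  set f : ℂ → ℂ := fun z : ℂ => if h : z = 0 then 0 else ((φ (Units.mk0 z h) : ℂˣ) : ℂ) with hf
  have f_mk0 : ∀ (z : ℂ) (hz : z ≠ 0), f z = ((φ (Units.mk0 z hz) : ℂˣ) : ℂ) := fun z hz => by
    simp only [hf, dif_neg hz]
  have f_units : ∀ u : ℂˣ, f u = ((φ u : ℂˣ) : ℂ) := fun u => by
    rw [f_mk0 u u.ne_zero, Units.mk0_val]
  have f_mul : ∀ z w : ℂ, z ≠ 0 → w ≠ 0 → f (z * w) = f z * f w := fun z w hz hw => by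
    rw [f_mk0 z hz, f_mk0 w hw, f_mk0 (z * w) (mul_ne_zero hz hw), Units.mk0_mul, map_mul,
      Units.val_mul]
  have f_one : f 1 = 1 := by
    rw [f_mk0 1 one_ne_zero, Units.mk0_one, map_one, Units.val_one]
  have f_diffAt : ∀ z : ℂ, z ≠ 0 → DifferentiableAt ℂ f z := fun z hz =>
    (hdiff z hz).differentiableAt (isOpen_ne.mem_nhds hz)
  -- `z · f'(z) = f(z) · c` with `c = f'(1)`
  set c : ℂ := deriv f 1 with hc
  have key : ∀ z : ℂ, z ≠ 0 → z * deriv f z = f z * c := by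
    intro z hz
    have h1 : HasDerivAt (fun w : ℂ => f (z * w)) (deriv f z * z) 1 := by
      have hz1 : HasDerivAt (fun w : ℂ => z * w) z 1 := hasDerivAt_const_mul z
      have hfz : HasDerivAt f (deriv f z) (z * 1) := by
        rw [mul_one]; exact (f_diffAt z hz).hasDerivAt
      exact hfz.comp 1 hz1
    have h2 : HasDerivAt (fun w : ℂ => f z * f w) (f z * c) 1 :=
      (f_diffAt 1 one_ne_zero).hasDerivAt.const_mul (f z)
    have heq : (fun w : ℂ => f z * f w) =ᶠ[nhds 1] (fun w : ℂ => f (z * w)) := by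
      filter_upwards [isOpen_ne.mem_nhds (one_ne_zero (α := ℂ))] with w hw
      exact (f_mul z w hz hw).symm
    have h3 : HasDerivAt (fun w : ℂ => f z * f w) (deriv f z * z) 1 := h1.congr_of_eventuallyEq heq
    have := h3.unique h2
    rw [mul_comm] at this
    exact this
  -- `F(t) := f(exp t) · exp(−c t)` is constant `= 1`
  set F : ℂ → ℂ := fun t => f (exp t) * exp (-(c * t)) with hF
  have hFd : ∀ t : ℂ, HasDerivAt F 0 t := by
    intro t
    have e1 : HasDerivAt (fun t : ℂ => f (exp t)) (deriv f (exp t) * exp t) t :=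
      (f_diffAt _ (exp_ne_zero t)).hasDerivAt.comp t (Complex.hasDerivAt_exp t)
    have e2 : HasDerivAt (fun t : ℂ => exp (-(c * t))) (exp (-(c * t)) * (-c)) t := by
      have hlin : HasDerivAt (fun t : ℂ => -(c * t)) (-c) t := (hasDerivAt_const_mul c).neg
      exact (Complex.hasDerivAt_exp _).comp t hlin
    have e3 := e1.mul e2
    have hk := key (exp t) (exp_ne_zero t)
    refine e3.congr_deriv ?_
    linear_combination (exp (-(c * t))) * hk
  have hFdiff : Differentiable ℂ F := fun t => (hFd t).differentiableAt
  have hFderiv : ∀ t, deriv F t = 0 := fun t => (hFd t).deriv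
  have hF1 : ∀ t : ℂ, F t = 1 := by
    intro t
    have := is_const_of_deriv_eq_zero hFdiff hFderiv t 0
    rw [this]
    simp only [hF, exp_zero, mul_zero, neg_zero, f_one, mul_one]
  have fexp : ∀ t : ℂ, f (exp t) = exp (c * t) := by
    intro t
    have h := hF1 t
    simp only [hF] at h
    calc f (exp t) = f (exp t) * exp (-(c * t)) * exp (c * t) := by
          rw [mul_assoc, ← exp_add, neg_add_cancel, exp_zero, mul_one]
      _ = exp (c * t) := by rw [h, one_mul]
  -- `c` is an integer
  have hcZ : ∃ n : ℤ, c = n := by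
    have h := fexp (2 * Real.pi * I)
    rw [exp_two_pi_mul_I, f_one] at h
    obtain ⟨n, hn⟩ := Complex.exp_eq_one_iff.mp h.symm
    refine ⟨n, ?_⟩
    have h2pi : (2 * Real.pi * I : ℂ) ≠ 0 := by
      simp [Real.pi_ne_zero, I_ne_zero]
    exact mul_right_cancel₀ h2pi hn
  obtain ⟨n, hn⟩ := hcZ
  refine ⟨n, fun u => Units.ext ?_⟩
  -- `f z = z ^ n`
  have h := fexp (log (u : ℂ))
  rw [exp_log u.ne_zero] at h
  rw [← f_units u, h, hn, exp_int_mul, exp_log u.ne_zero, Units.val_zpow_eq_zpow_val]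

end Literature.IUT.HodgeTheaters
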